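import Summits.FinalStateConjecture.FinalStateConjecture.Theorems.PhotonSphereChannelsDarkFutureDefs
import Summits.FinalStateConjecture.FinalStateConjecture.Theorems.PhotonSphereChannelsChannelsResolveTameDevelopmentsRHullKretschmannBase
import HarnessLib

/-!
# Route PhotonSphereChannels · crux `ChannelsResolveTameDevelopmentsR` (K2R-T2, stmt-FinalStateConjecture-17430) —
# curvature at the base point of HORIZON-hull elements along a generator path: the closedness (B2) and pinning (B4)
# inputs of stub K `stub_kerrLocusClopen` (line `dark-future-exactness`), curvature half

The based hull `Ω_γ` of stub K consists of horizon-hull elements `(𝓢, E, p)` along a horizon generator path `γ` of a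
development `𝒟` (`TameHull.IsHorizonHullElement`: pointed `C²_loc` limits of `(𝒟, γ(sₙ))`, `sₙ → +∞`, based at
`p ∈ E.horizon`). K's intended proof needs (B2) "the Kerr locus at fixed parameters is CLOSED in `Ω_γ` — limits of
exactly-Kerr d.o.c.s based on their horizons do not degenerate to flat" and (B4) "PINNING — the Kerr parameters realised on
`Ω_γ` are finitely many". With the landed continuity of the Kretschmann scalar under pointed `C²` convergence
(`HullCurvature.tendsto_kretschmannAt_basepoint`, `…RHullKretschmann(Base)`) and the Kerr-doc curvature dictionary
(`…RKerrDocCurvature`), this file proves the CURVATURE HALF of both, for the whole based hull at once and without any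
topology on `Ω_γ`:

* §1 **The base-point curvature is a cluster value of the development's curvature along `γ`.** For every horizon-hull
  element `(𝓢, E, p)` along `γ`, `|Rm|²_𝓢(p)` is a cluster point at `+∞` of `f_γ := s ↦ |Rm|²_𝒟(γ s)`
  (`mapClusterPt_kretschmannAt_of_isHorizonHullElement`); hence eventual bounds `κ ≤ f_γ` / `f_γ ≤ κ` pass to every
  element of `Ω_γ`, and if `f_γ → K` then `|Rm|²_𝓢(p) = K` for EVERY element of `Ω_γ`
  (`kretschmannAt_eq_of_isHorizonHullElement_of_tendsto`): the base-point curvature is constant on the based hull.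
* §2 **(B2), curvature half — no degeneration to flat on `Ω_γ`.** A curvature floor `κ ≤ f_γ` eventually (`κ > 0`), or
  `f_γ → K ≠ 0`, forbids EVERY horizon-hull element along `γ` from being a Minkowski space
  (`not_isMinkowski_of_isHorizonHullElement_of_le`, `…_of_tendsto`); and the hull-topology form: a pointed `C²` limit
  `(𝓢, p)` of ANY sequence of elements of `Ω_γ` (based at their base points) again has `|Rm|²_𝓢(p) = K`, hence is not
  Minkowski (`kretschmannAt_eq_of_subconvergesLocallyTo_hullElts`) — the closure of `Ω_γ` in the intended topology stays
  off the flat locus.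
* §3 **(B4), curvature half — Schwarzschild masses on `Ω_γ` are bounded by the curvature floor**: an element of `Ω_γ` with
  d.o.c. exactly Schwarzschild of mass `M > 0` has `M⁴ ≤ ¾ κ⁻¹` (`|Rm|² < ¾M⁻⁴` on the doc passes to its closure, which
  contains `E.horizon ∋ p`; `mass_pow_four_le_of_isHorizonHullElement_schwarzschildDoc`).
* §4 **Exact pinning modulo localisation.** On the image of an exact Kerr chart the host's Kretschmann scalar IS Kerr's
  (`kretschmannAt_kerrChart`, pointwise); if the base point is HORIZON-LOCALISED in a Schwarzschild chart of the doc
  (approached by chart points with `r → 2M`), then `|Rm|²_𝓢(p) = ¾M⁻⁴` (`kretschmannAt_eq_of_horizonLocalised`), so with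
  §1, `M⁴ · K = ¾` and TWO horizon-localised Schwarzschild elements along the same `γ` have the SAME mass when `f_γ`
  converges (`schwarzschild_mass_eq_of_horizonLocalised_of_tendsto`) — pinning of `M` for `a = 0`.

What remains of (B2)/(B4) after this file (reported to the lead): (L) LOCALISATION — `p ∈ E.horizon ⊆ closure E.doc` does
not place `p` at `r = r₊` of the doc's Kerr chart (`closure (range Ψ)` also contains the ideal points `r → ∞`,
`t* → ±∞`, where `|Rm|² → [0, ¾M⁻⁴)`), so neither "Kerr-doc elements are non-flat at `p`" nor `|Rm|²(p) = ` horizon value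
follows from `IsKerrDoc` alone; (F) convergence (or finiteness of the cluster set) of `f_γ` — a statement about the
development only; (R) local-isometry rigidity of `C²` limits of exactly-Kerr regions and doc-semicontinuity (the
non-curvature half of B2); and for `a ≠ 0` one scalar invariant at one point cannot pin `(M, a)` (the Kerr horizon value
`48M² Re (r₊ + i a cos θ)⁶/Σ⁶` depends on the latitude of `p`) — the area theorem / mass budget remain the pinning input.

All results proved; no definitions.

References: P. Petersen, *Riemannian Geometry*, 2nd ed. (2006), Ch. 10 §3.2 [Petersen2006]; M. Visser, arXiv:0706.0622,
§3 [arXiv07060622]; B. O'Neill 1983, Ch. 3, Prop. 3.41 / 3.59 [ONeill1983]; Hale 1980, Ch. I §8 [Hale1980].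
-/

noncomputable section

-- the operator-norm instance on `E4 →L[ℝ] E4 →L[ℝ] ℝ` needs one more level of pending
-- instance problems than the default (as in `PhotonSphereChannelsTameHullDefs.lean`)
set_option maxSynthPendingDepth 3
-- every `Summit.FinalStateConjecture.FinalStateConjecture.…` name repeats the summit = sub-problem segment (D-0017 layout)
set_option linter.dupNamespace false

open Set Filter Function TopologicalSpace Metric
open scoped Topology Manifold ContDiff ENNReal NNReal

namespace Summit.FinalStateConjecture.FinalStateConjecture.Theorems.DarkFuture

open Literature.Geometry.Lorentzian
open Summit.FinalStateConjecture.FinalStateConjecture.Theorems.TameHull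
open Summit.FinalStateConjecture.FinalStateConjecture.Theorems.HullCurvature

section Along

variable {X : Type} [TopologicalSpace X] [ChartedSpace E3 X] [IsManifold (𝓡 3) ∞ X] [ConnectedSpace X]
  {D : InitialDataSet (𝓡 3) X} {𝒟 : VacuumCauchyDevelopment D} [𝒟.metric.HasLeviCivita]
  {Λ : ℕ → ℝ≥0} {r₀ : ℝ} {γ : ℝ → 𝒟.carrier} {𝓢 : Spacetime.{0} 4} {E : EndDatum 𝓢} {p : 𝓢.carrier}

/-! ### §1 The base-point curvature of a horizon-hull element is a cluster value of `|Rm|²_𝒟 ∘ γ` at `+∞` -/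

/-- **Along the parameter sequence**: for a horizon-hull element `(𝓢, E, p)` along `γ ∘ s`, `|Rm|²_𝓢(p)` is a cluster
point of `n ↦ |Rm|²_𝒟(γ(s n))` (the comparison maps send `p` to `γ(s (sub n))` and the scalars converge along `sub`,
`tendsto_kretschmannAt_basepoint`). [cite: Petersen2006, Ch. 10 §3.2] -/
theorem mapClusterPt_kretschmannAt_of_isHorizonHullElementAlong {s : ℕ → ℝ}
    (h : IsHorizonHullElementAlong 𝒟 Λ r₀ γ s 𝓢 E p) :
    MapClusterPt (𝓢.kretschmannAt p) atTop (fun n ↦ 𝒟.toSpacetime.kretschmannAt (γ (s n))) := by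
  obtain ⟨D⟩ := h.2.2.2
  have hlim : Tendsto ((fun n ↦ 𝒟.toSpacetime.kretschmannAt (γ (s n))) ∘ D.sub) atTop
      (𝓝 (𝓢.kretschmannAt p)) :=
    tendsto_kretschmannAt_basepoint D le_rfl
  exact MapClusterPt.of_comp D.strictMono_sub.tendsto_atTop hlim.mapClusterPt

/-- **The base-point curvature is a cluster value of the development's curvature along `γ`**: for every horizon-hull
element `(𝓢, E, p)` along `γ`, `|Rm|²_𝓢(p)` is a cluster point at `+∞` of `f_γ = s ↦ |Rm|²_𝒟(γ s)`.
[cite: Petersen2006, Ch. 10 §3.2] -/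
theorem mapClusterPt_kretschmannAt_of_isHorizonHullElement (h : IsHorizonHullElement 𝒟 Λ r₀ γ 𝓢 E p) :
    MapClusterPt (𝓢.kretschmannAt p) atTop (fun t : ℝ ↦ 𝒟.toSpacetime.kretschmannAt (γ t)) := by
  obtain ⟨s, hs, hZ⟩ := h
  exact MapClusterPt.of_comp hs (mapClusterPt_kretschmannAt_of_isHorizonHullElementAlong hZ)

/-- **Eventual lower bounds along `γ` pass to every element of `Ω_γ`.** [cite: Petersen2006, Ch. 10 §3.2] -/
theorem le_kretschmannAt_of_isHorizonHullElement (h : IsHorizonHullElement 𝒟 Λ r₀ γ 𝓢 E p) {κ : ℝ}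
    (hκ : ∀ᶠ t in atTop, κ ≤ 𝒟.toSpacetime.kretschmannAt (γ t)) : κ ≤ 𝓢.kretschmannAt p :=
  isClosed_Ici.mem_of_mapClusterPt (mapClusterPt_kretschmannAt_of_isHorizonHullElement h) hκ

/-- **Eventual upper bounds along `γ` pass to every element of `Ω_γ`.** [cite: Petersen2006, Ch. 10 §3.2] -/
theorem kretschmannAt_le_of_isHorizonHullElement (h : IsHorizonHullElement 𝒟 Λ r₀ γ 𝓢 E p) {κ : ℝ}
    (hκ : ∀ᶠ t in atTop, 𝒟.toSpacetime.kretschmannAt (γ t) ≤ κ) : 𝓢.kretschmannAt p ≤ κ :=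
  isClosed_Iic.mem_of_mapClusterPt (mapClusterPt_kretschmannAt_of_isHorizonHullElement h) hκ

/-- **The base-point curvature is CONSTANT on the based hull when `|Rm|²_𝒟 ∘ γ` converges**: if
`|Rm|²_𝒟(γ s) → K` as `s → +∞`, then `|Rm|²_𝓢(p) = K` for EVERY horizon-hull element `(𝓢, E, p)` along `γ` (a cluster
point of a convergent map is its limit; Hausdorff). [cite: Petersen2006, Ch. 10 §3.2] -/
theorem kretschmannAt_eq_of_isHorizonHullElement_of_tendsto (h : IsHorizonHullElement 𝒟 Λ r₀ γ 𝓢 E p) {K : ℝ}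
    (hK : Tendsto (fun t : ℝ ↦ 𝒟.toSpacetime.kretschmannAt (γ t)) atTop (𝓝 K)) : 𝓢.kretschmannAt p = K :=
  eq_of_nhds_neBot ((mapClusterPt_kretschmannAt_of_isHorizonHullElement h).clusterPt.mono hK)

/-! ### §2 (B2), curvature half: no degeneration to flat on the based hull `Ω_γ` -/

/-- **A curvature floor along `γ` forbids degeneration to flat on ALL of `Ω_γ`**: if eventually `κ ≤ |Rm|²_𝒟(γ s)` with
`κ > 0`, then every horizon-hull element `(𝓢, E, p)` along `γ` has `κ ≤ |Rm|²_𝓢(p)` and `𝓢` is NOT a Minkowski space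
(`kretschmannAt_eq_zero_of_isMinkowski`). Topology-free: it holds for every element, hence for every subset or closure
of `Ω_γ` one may later form. [cite: ONeill1983, Ch. 3, Prop. 3.41] -/
theorem not_isMinkowski_of_isHorizonHullElement_of_le (h : IsHorizonHullElement 𝒟 Λ r₀ γ 𝓢 E p) {κ : ℝ}
    (hκ : 0 < κ) (hle : ∀ᶠ t in atTop, κ ≤ 𝒟.toSpacetime.kretschmannAt (γ t)) :
    κ ≤ 𝓢.kretschmannAt p ∧ ¬ IsMinkowski 𝓢 := by
  have h1 := le_kretschmannAt_of_isHorizonHullElement h hle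
  exact ⟨h1, not_isMinkowski_of_kretschmannAt_ne_zero (x := p) (by linarith)⟩

/-- The same with a NEGATIVE curvature ceiling (`|Rm|²_𝒟(γ s) ≤ −κ < 0` eventually; the Kretschmann scalar of a
Lorentzian metric has no sign). [cite: ONeill1983, Ch. 3, Prop. 3.41] -/
theorem not_isMinkowski_of_isHorizonHullElement_of_le_neg (h : IsHorizonHullElement 𝒟 Λ r₀ γ 𝓢 E p) {κ : ℝ}
    (hκ : 0 < κ) (hle : ∀ᶠ t in atTop, 𝒟.toSpacetime.kretschmannAt (γ t) ≤ -κ) :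
    𝓢.kretschmannAt p ≤ -κ ∧ ¬ IsMinkowski 𝓢 := by
  have h1 := kretschmannAt_le_of_isHorizonHullElement h hle
  exact ⟨h1, not_isMinkowski_of_kretschmannAt_ne_zero (x := p) (by linarith)⟩

/-- **Convergent nonzero curvature along `γ` forbids degeneration to flat on ALL of `Ω_γ`.** [cite: ONeill1983, Ch. 3, Prop. 3.41] -/
theorem not_isMinkowski_of_isHorizonHullElement_of_tendsto (h : IsHorizonHullElement 𝒟 Λ r₀ γ 𝓢 E p) {K : ℝ}
    (hK : Tendsto (fun t : ℝ ↦ 𝒟.toSpacetime.kretschmannAt (γ t)) atTop (𝓝 K)) (hK0 : K ≠ 0) :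
    𝓢.kretschmannAt p = K ∧ ¬ IsMinkowski 𝓢 := by
  have h1 := kretschmannAt_eq_of_isHorizonHullElement_of_tendsto h hK
  exact ⟨h1, not_isMinkowski_of_kretschmannAt_ne_zero (x := p) (h1 ▸ hK0)⟩

/-- **(B2) in hull-topology form, curvature half.** Let `(𝓢ⱼ, Eⱼ, pⱼ)` be ANY sequence of horizon-hull elements along
`γ` and `(𝓢, p)` a pointed `C²` limit of `(𝓢ⱼ, pⱼ)` (the intended topology on `Ω_γ`; `𝓢` need not be known to lie in
`Ω_γ`). If `|Rm|²_𝒟(γ s) → K`, then `|Rm|²_𝓢(p) = K` (every `|Rm|²_{𝓢ⱼ}(pⱼ)` equals `K` by §1, and base-point scalars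
converge along the datum), and `𝓢` is not a Minkowski space when `K ≠ 0`: the closure of the based hull stays off the
flat locus. [cite: Petersen2006, Ch. 10 §3.2] -/
theorem kretschmannAt_eq_of_subconvergesLocallyTo_hullElts {𝓢ⱼ : ℕ → Spacetime.{0} 4} {Eⱼ : ∀ j, EndDatum (𝓢ⱼ j)}
    {pⱼ : ∀ j, (𝓢ⱼ j).carrier} (hZ : ∀ j, IsHorizonHullElement 𝒟 Λ r₀ γ (𝓢ⱼ j) (Eⱼ j) (pⱼ j))
    (hlim : Spacetime.SubconvergesLocallyTo 𝓢ⱼ pⱼ 𝓢 p 2) {K : ℝ}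
    (hK : Tendsto (fun t : ℝ ↦ 𝒟.toSpacetime.kretschmannAt (γ t)) atTop (𝓝 K)) :
    𝓢.kretschmannAt p = K ∧ (K ≠ 0 → ¬ IsMinkowski 𝓢) := by
  have hj : ∀ j, (𝓢ⱼ j).kretschmannAt (pⱼ j) = K :=
    fun j ↦ kretschmannAt_eq_of_isHorizonHullElement_of_tendsto (hZ j) hK
  have hle : K ≤ 𝓢.kretschmannAt p :=
    le_kretschmannAt_of_subconvergesLocallyTo hlim le_rfl (Eventually.of_forall fun j ↦ (hj j).ge)
  have hge : 𝓢.kretschmannAt p ≤ K :=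
    kretschmannAt_le_of_subconvergesLocallyTo hlim le_rfl (Eventually.of_forall fun j ↦ (hj j).le)
  have heq : 𝓢.kretschmannAt p = K := le_antisymm hge hle
  exact ⟨heq, fun hK0 ↦ not_isMinkowski_of_kretschmannAt_ne_zero (x := p) (heq ▸ hK0)⟩

/-! ### §3 (B4), curvature half: Schwarzschild masses on `Ω_γ` are bounded by the curvature floor along `γ` -/

/-- **Mass bound for Schwarzschild elements of the based hull.** If eventually `κ ≤ |Rm|²_𝒟(γ s)` with `κ > 0` and the
horizon-hull element `(𝓢, E, p)` along `γ` has d.o.c. exactly Schwarzschild of mass `M > 0` (`IsKerrDoc 𝓢 E.doc M 0`),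
then `M⁴ ≤ ¾ κ⁻¹`: `κ ≤ |Rm|²_𝓢(p)` by §1, while `|Rm|² < ¾M⁻⁴` on the doc (`48M²/r⁶`, `r > 2M`) passes to its closure,
which contains `E.horizon ∋ p`. One of the two inequalities of PINNING for `a = 0`. [cite: arXiv07060622, §3] -/
theorem mass_pow_four_le_of_isHorizonHullElement_schwarzschildDoc (h : IsHorizonHullElement 𝒟 Λ r₀ γ 𝓢 E p)
    {M : ℝ} (hM : 0 < M) (hdoc : IsKerrDoc 𝓢 E.doc M 0) {κ : ℝ} (hκ : 0 < κ)
    (hle : ∀ᶠ t in atTop, κ ≤ 𝒟.toSpacetime.kretschmannAt (γ t)) : M ^ 4 ≤ 3 / (4 * κ) := by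
  obtain ⟨s, hs, hZ⟩ := h
  have hp : p ∈ closure E.doc := horizon_subset_closure_doc E hZ.2.2.1
  have hlow : κ ≤ 𝓢.kretschmannAt p := le_kretschmannAt_of_isHorizonHullElement ⟨s, hs, hZ⟩ hle
  have hup : 𝓢.kretschmannAt p ≤ 3 / (4 * M ^ 4) :=
    kretschmannAt_le_of_mem_closure
      (fun y hy ↦ (kretschmannAt_pos_lt_of_isKerrDoc_schwarzschild hdoc hM hy).2.le) hp
  have h1 : κ ≤ 3 / (4 * M ^ 4) := hlow.trans hup
  rw [le_div_iff₀ (by positivity)] at h1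
  rw [le_div_iff₀ (by positivity)]
  nlinarith

/-- **Mass bound under convergent curvature along `γ`**: if `|Rm|²_𝒟(γ s) → K > 0`, every Schwarzschild element of
`Ω_γ` has `M⁴ ≤ ¾ K⁻¹`. [cite: arXiv07060622, §3] -/
theorem mass_pow_four_le_of_isHorizonHullElement_schwarzschildDoc_of_tendsto
    (h : IsHorizonHullElement 𝒟 Λ r₀ γ 𝓢 E p) {M : ℝ} (hM : 0 < M) (hdoc : IsKerrDoc 𝓢 E.doc M 0) {K : ℝ}
    (hK : Tendsto (fun t : ℝ ↦ 𝒟.toSpacetime.kretschmannAt (γ t)) atTop (𝓝 K)) (hK0 : 0 < K) :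
    M ^ 4 ≤ 3 / (4 * K) := by
  obtain ⟨s, hs, hZ⟩ := h
  have hp : p ∈ closure E.doc := horizon_subset_closure_doc E hZ.2.2.1
  have heq : 𝓢.kretschmannAt p = K := kretschmannAt_eq_of_isHorizonHullElement_of_tendsto ⟨s, hs, hZ⟩ hK
  have hup : 𝓢.kretschmannAt p ≤ 3 / (4 * M ^ 4) :=
    kretschmannAt_le_of_mem_closure
      (fun y hy ↦ (kretschmannAt_pos_lt_of_isKerrDoc_schwarzschild hdoc hM hy).2.le) hp
  rw [heq, le_div_iff₀ (by positivity)] at hup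
  rw [le_div_iff₀ (by positivity)]
  nlinarith

end Along

/-! ### §4 Exact pinning modulo localisation of the base point at the horizon of the doc's Kerr chart -/

/-- **On the image of an exact Kerr chart the host's Kretschmann scalar is Kerr's, pointwise**: if
`Ψ : Kerr.exterior M a → 𝓢` is smooth with `Ψ^* g = g_{M,a}` (`𝓢.deviation (Kerr.background M a) Ψ ≡ 0`), `0 ≤ M`, then
`|Rm|²_𝓢(Ψ x) = |Rm|²_{g_{M,a}}(x)` for every `x` (`Ψ` is an isometric immersion of `Kerr.spacetime M a r₊`; transport by
`kretschmannAt_comp_of_isIsometricImmersion` and the chart value `Kerr.kretschmannAt_spacetime`). [cite: arXiv07060622, §3] -/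
theorem kretschmannAt_kerrChart {𝓢 : Spacetime.{0} 4} {M a : ℝ} (hM : 0 ≤ M) {Ψ : Kerr.exterior M a → 𝓢.carrier}
    (hsmooth : ContMDiff 𝓘(ℝ, E4) (𝓡 4) ∞ Ψ) (hdev : ∀ x, 𝓢.deviation (Kerr.background M a) Ψ x = 0)
    (x : Kerr.exterior M a) : 𝓢.kretschmannAt (Ψ x) = MetricCoord.rmNormSqAt (Kerr.bilin M a) x.1 := by
  haveI : Kerr.Facts :=
    ⟨Kerr.isConnected_region_holds, Kerr.contMDiff_bilin_holds, Kerr.contMDiff_timeVector_holds⟩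
  have hE : (Kerr.spacetime M a (Kerr.rPlus M a) hM).metric.IsIsometricImmersion
      𝓢.metric.toPseudoRiemannianMetric Ψ := by
    refine ⟨hsmooth, fun z ↦ ?_⟩
    have h := hdev z
    rw [Spacetime.deviation, sub_eq_zero] at h
    exact h
  rw [Spacetime.kretschmannAt_comp_of_isIsometricImmersion (𝓢 := 𝓢)
    (𝓤 := Kerr.spacetime M a (Kerr.rPlus M a) hM) hE x]
  exact (Kerr.kretschmannAt_spacetime Kerr.kretschmannScalar_closedForm_holds M a (Kerr.rPlus M a) hM x).trans
    (Kerr.kretschmannScalar_closedForm_holds M a x.1 (Kerr.radius_pos_of_mem_region x.2)).symm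

/-- **Schwarzschild chart: curvature floor near the horizon.** For a smooth exact Schwarzschild chart `Ψ` of mass `M > 0`
and every `R`, every point of `closure (Ψ '' {r ≤ R})` has `|Rm|² ≥ 48M²/R⁶` (`48M²/r⁶` is antitone in `r > 0`, and the
set is empty unless `R > 2M`; bounds pass to the closure). [cite: arXiv07060622, §3] -/
theorem le_kretschmannAt_of_mem_closure_schwarzschildChart {𝓢 : Spacetime.{0} 4} {M : ℝ} (hM : 0 < M)
    {Ψ : Kerr.exterior M 0 → 𝓢.carrier} (hsmooth : ContMDiff 𝓘(ℝ, E4) (𝓡 4) ∞ Ψ)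
    (hdev : ∀ x, 𝓢.deviation (Kerr.background M 0) Ψ x = 0) {R : ℝ} {p : 𝓢.carrier}
    (hp : p ∈ closure (Ψ '' {x | Kerr.radius 0 x.1 ≤ R})) : 48 * M ^ 2 / R ^ 6 ≤ 𝓢.kretschmannAt p := by
  refine le_kretschmannAt_of_mem_closure (fun y hy ↦ ?_) hp
  obtain ⟨x, hx, rfl⟩ := hy
  have hr : 0 < Kerr.radius 0 x.1 := Kerr.radius_pos_of_mem_region x.2
  rw [kretschmannAt_kerrChart hM.le hsmooth hdev x, rmNormSqAt_schwarzschild M hr]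
  have h6 : Kerr.radius 0 x.1 ^ 6 ≤ R ^ 6 := pow_le_pow_left₀ hr.le hx 6
  exact div_le_div_of_nonneg_left (by positivity) (by positivity) h6

/-- **Horizon-localised base points of Schwarzschild charts carry the horizon value `|Rm|² = ¾M⁻⁴`.** If `Ψ` is a
smooth exact Schwarzschild chart of mass `M > 0` into `𝓢` and `p` is approached by chart points with `r → 2M`
(`p ∈ closure (Ψ '' {r ≤ 2M + ε})` for every `ε > 0` — LOCALISATION of `p` at the future event horizon of the chart,
the input (L) that `p ∈ E.horizon` alone does not supply), then `|Rm|²_𝓢(p) = 48M²/(2M)⁶ = ¾M⁻⁴`: `≥` from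
`le_kretschmannAt_of_mem_closure_schwarzschildChart` as `ε → 0`, `≤` because `|Rm|² < ¾M⁻⁴` on the whole chart image
(`r > 2M`). [cite: arXiv07060622, §3] -/
theorem kretschmannAt_eq_of_horizonLocalised {𝓢 : Spacetime.{0} 4} {M : ℝ} (hM : 0 < M)
    {Ψ : Kerr.exterior M 0 → 𝓢.carrier} (hsmooth : ContMDiff 𝓘(ℝ, E4) (𝓡 4) ∞ Ψ)
    (hdev : ∀ x, 𝓢.deviation (Kerr.background M 0) Ψ x = 0) {p : 𝓢.carrier}
    (hloc : ∀ ε > (0 : ℝ), p ∈ closure (Ψ '' {x | Kerr.radius 0 x.1 ≤ 2 * M + ε})) :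
    𝓢.kretschmannAt p = 3 / (4 * M ^ 4) := by
  -- upper bound on the whole chart image
  have hup : 𝓢.kretschmannAt p ≤ 3 / (4 * M ^ 4) := by
    have hp1 : p ∈ closure (Set.range Ψ) :=
      closure_mono (image_subset_range _ _) (hloc 1 one_pos)
    refine kretschmannAt_le_of_mem_closure (fun y hy ↦ ?_) hp1
    obtain ⟨x, rfl⟩ := hy
    have hx' : max (Kerr.rPlus M 0) 0 < Kerr.radius 0 x.1 := Kerr.mem_region.1 x.2
    have hr2M : 2 * M < Kerr.radius 0 x.1 := by
      rw [Kerr.rPlus_zero_right hM.le] at hx'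
      exact (le_max_left _ _).trans_lt hx'
    have hr : 0 < Kerr.radius 0 x.1 := by linarith
    rw [kretschmannAt_kerrChart hM.le hsmooth hdev x, rmNormSqAt_schwarzschild M hr]
    rw [div_le_div_iff₀ (by positivity) (by positivity)]
    have h2 : (2 * M) ^ 6 < Kerr.radius 0 x.1 ^ 6 := pow_lt_pow_left₀ hr2M (by positivity) (by norm_num)
    nlinarith [h2]
  -- lower bound: `48 M² / (2M + ε)⁶ ≤ |Rm|²(p)` for every `ε > 0`, and `ε → 0`
  have hlow : ∀ ε > (0 : ℝ), 48 * M ^ 2 / (2 * M + ε) ^ 6 ≤ 𝓢.kretschmannAt p := fun ε hε ↦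
    le_kretschmannAt_of_mem_closure_schwarzschildChart hM hsmooth hdev (hloc ε hε)
  have hcont : Tendsto (fun ε : ℝ ↦ 48 * M ^ 2 / (2 * M + ε) ^ 6) (𝓝[>] 0) (𝓝 (48 * M ^ 2 / (2 * M + 0) ^ 6)) := by
    refine Tendsto.mono_left ?_ nhdsWithin_le_nhds
    exact tendsto_const_nhds.div ((tendsto_const_nhds.add tendsto_id).pow 6) (by positivity)
  have hge : 48 * M ^ 2 / (2 * M + 0) ^ 6 ≤ 𝓢.kretschmannAt p :=
    le_of_tendsto hcont (eventually_nhdsWithin_of_forall fun ε hε ↦ hlow ε hε)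
  have hval : 48 * M ^ 2 / (2 * M + 0) ^ 6 = 3 / (4 * M ^ 4) := by
    rw [add_zero]
    have hM0 : M ≠ 0 := hM.ne'
    field_simp
    ring
  rw [hval] at hge
  exact le_antisymm hup hge

section Pinning

variable {X : Type} [TopologicalSpace X] [ChartedSpace E3 X] [IsManifold (𝓡 3) ∞ X] [ConnectedSpace X]
  {D : InitialDataSet (𝓡 3) X} {𝒟 : VacuumCauchyDevelopment D} [𝒟.metric.HasLeviCivita]
  {Λ : ℕ → ℝ≥0} {r₀ : ℝ} {γ : ℝ → 𝒟.carrier}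

/-- **Pinning relation for horizon-localised Schwarzschild elements of the based hull**: if `|Rm|²_𝒟(γ s) → K` and the
horizon-hull element `(𝓢, E, p)` along `γ` carries a smooth exact Schwarzschild chart of mass `M > 0` in which `p` is
horizon-localised, then `M⁴ · K = ¾` — the mass is DETERMINED by the development's curvature along `γ`.
[cite: arXiv07060622, §3] -/
theorem mass_pow_four_mul_eq_of_horizonLocalised_of_tendsto {𝓢 : Spacetime.{0} 4} {E : EndDatum 𝓢} {p : 𝓢.carrier}
    (h : IsHorizonHullElement 𝒟 Λ r₀ γ 𝓢 E p) {K : ℝ}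
    (hK : Tendsto (fun t : ℝ ↦ 𝒟.toSpacetime.kretschmannAt (γ t)) atTop (𝓝 K)) {M : ℝ} (hM : 0 < M)
    {Ψ : Kerr.exterior M 0 → 𝓢.carrier} (hsmooth : ContMDiff 𝓘(ℝ, E4) (𝓡 4) ∞ Ψ)
    (hdev : ∀ x, 𝓢.deviation (Kerr.background M 0) Ψ x = 0)
    (hloc : ∀ ε > (0 : ℝ), p ∈ closure (Ψ '' {x | Kerr.radius 0 x.1 ≤ 2 * M + ε})) : M ^ 4 * K = 3 / 4 := by
  have h1 := kretschmannAt_eq_of_isHorizonHullElement_of_tendsto h hK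
  have h2 := kretschmannAt_eq_of_horizonLocalised hM hsmooth hdev hloc
  rw [h1] at h2
  rw [h2]
  have hM0 : M ≠ 0 := hM.ne'
  field_simp

/-- **PINNING of Schwarzschild masses along `γ` modulo (L) localisation and (F) convergence**: two horizon-hull elements
along the SAME generator path `γ`, each carrying a smooth exact Schwarzschild chart (masses `M₁, M₂ > 0`) in which its base
point is horizon-localised, have `M₁ = M₂` as soon as `|Rm|²_𝒟 ∘ γ` converges at `+∞` (both satisfy `M⁴ · K = ¾`).
[cite: arXiv07060622, §3] -/
theorem schwarzschild_mass_eq_of_horizonLocalised_of_tendsto {K : ℝ}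
    (hK : Tendsto (fun t : ℝ ↦ 𝒟.toSpacetime.kretschmannAt (γ t)) atTop (𝓝 K))
    {𝓢₁ : Spacetime.{0} 4} {E₁ : EndDatum 𝓢₁} {p₁ : 𝓢₁.carrier} (h₁ : IsHorizonHullElement 𝒟 Λ r₀ γ 𝓢₁ E₁ p₁)
    {M₁ : ℝ} (hM₁ : 0 < M₁) {Ψ₁ : Kerr.exterior M₁ 0 → 𝓢₁.carrier} (hs₁ : ContMDiff 𝓘(ℝ, E4) (𝓡 4) ∞ Ψ₁)
    (hd₁ : ∀ x, 𝓢₁.deviation (Kerr.background M₁ 0) Ψ₁ x = 0)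
    (hl₁ : ∀ ε > (0 : ℝ), p₁ ∈ closure (Ψ₁ '' {x | Kerr.radius 0 x.1 ≤ 2 * M₁ + ε}))
    {𝓢₂ : Spacetime.{0} 4} {E₂ : EndDatum 𝓢₂} {p₂ : 𝓢₂.carrier} (h₂ : IsHorizonHullElement 𝒟 Λ r₀ γ 𝓢₂ E₂ p₂)
    {M₂ : ℝ} (hM₂ : 0 < M₂) {Ψ₂ : Kerr.exterior M₂ 0 → 𝓢₂.carrier} (hs₂ : ContMDiff 𝓘(ℝ, E4) (𝓡 4) ∞ Ψ₂)
    (hd₂ : ∀ x, 𝓢₂.deviation (Kerr.background M₂ 0) Ψ₂ x = 0)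
    (hl₂ : ∀ ε > (0 : ℝ), p₂ ∈ closure (Ψ₂ '' {x | Kerr.radius 0 x.1 ≤ 2 * M₂ + ε})) : M₁ = M₂ := by
  have e₁ := mass_pow_four_mul_eq_of_horizonLocalised_of_tendsto h₁ hK hM₁ hs₁ hd₁ hl₁
  have e₂ := mass_pow_four_mul_eq_of_horizonLocalised_of_tendsto h₂ hK hM₂ hs₂ hd₂ hl₂
  have hK0 : K ≠ 0 := by
    rintro rfl
    norm_num at e₁
  have h4 : M₁ ^ 4 = M₂ ^ 4 := mul_right_cancel₀ hK0 (e₁.trans e₂.symm)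
  exact (pow_left_inj₀ hM₁.le hM₂.le (by norm_num)).1 h4

end Pinning

/-! ### §5 Registered summary (sub-goal of stub K) -/

/-- **Registered sub-goal of stub K — curvature half of (B2) closedness and (B4) pinning on the based hull `Ω_γ`.**
For every horizon generator path `γ` with `|Rm|²_𝒟(γ s) → K` as `s → +∞`: every horizon-hull element `(𝓢, E, p)` along
`γ` has `|Rm|²_𝓢(p) = K`; if `K ≠ 0` none of them is a Minkowski space; and if `K > 0` every element whose d.o.c. is
exactly Schwarzschild of mass `M > 0` has `M⁴ ≤ ¾ K⁻¹`. [cite: Petersen2006, Ch. 10 §3.2] -/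
theorem horizonHull_basepoint_curvature_along : ∀ {X : Type} [TopologicalSpace X] [ChartedSpace E3 X] [IsManifold (𝓡 3) ∞ X] [ConnectedSpace X] {D : InitialDataSet (𝓡 3) X} {𝒟 : VacuumCauchyDevelopment D} [𝒟.metric.HasLeviCivita] {Λ : ℕ → ℝ≥0} {r₀ : ℝ} {γ : ℝ → 𝒟.carrier} {K : ℝ}, Tendsto (fun t : ℝ ↦ 𝒟.toSpacetime.kretschmannAt (γ t)) atTop (𝓝 K) → ∀ (𝓢 : Spacetime.{0} 4) (E : EndDatum 𝓢) (p : 𝓢.carrier), IsHorizonHullElement 𝒟 Λ r₀ γ 𝓢 E p → 𝓢.kretschmannAt p = K ∧ (K ≠ 0 → ¬ IsMinkowski 𝓢) ∧ ∀ M : ℝ, 0 < M → 0 < K → IsKerrDoc 𝓢 E.doc M 0 → M ^ 4 ≤ 3 / (4 * K) := by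
  intro X _ _ _ _ D 𝒟 _ Λ r₀ γ K hK 𝓢 E p h
  refine ⟨kretschmannAt_eq_of_isHorizonHullElement_of_tendsto h hK,
    fun hK0 ↦ (not_isMinkowski_of_isHorizonHullElement_of_tendsto h hK hK0).2,
    fun M hM hK0 hdoc ↦ mass_pow_four_le_of_isHorizonHullElement_schwarzschildDoc_of_tendsto h hM hdoc hK hK0⟩

end Summit.FinalStateConjecture.FinalStateConjecture.Theorems.DarkFuture

end
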